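import Mathlib
import Literature.RepresentationTheory.Semisimple.FiniteFieldDescentFinTwo

/-!
# SoloBlind: the two elementary group-theoretic steps of the socle lemma Ψ1

In the study of the all-plus Eisenstein torsion `J^N[𝔫⁺]` of a Shimura-curve Jacobian
(side line O1b, PROPOSITION Ψ, `paper/theoremPhi.md` §5(j)) the Eichler–Shimura relation gives,
for every Galois element `g`, `(g - 1)(g - χ g) = 0` on `J^N[𝔫⁺]` (`χ` the mod-`ℓ` cyclotomic
character).  Two purely algebraic facts finish the proof that every simple constituent is
`𝟙` or `χ`:

* `soloBlind_hom_dichotomy`: if a homomorphism `ψ` agrees *pointwise* with one of two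
  homomorphisms `χ₁`, `χ₂` (which one may depend on the point), then it agrees *globally* with
  one of them — because a group is never the union of two proper subgroups
  (`Literature.RepresentationTheory.Semisimple.subgroup_eq_top_or_eq_top_of_union`, reused in
  `soloBlind_hom_dichotomy'`);
* `soloBlind_unipotent_pow_char`: in characteristic `ℓ`, an element `1 + u` with `u ^ 2 = 0`
  satisfies `(1 + u) ^ ℓ = 1` — so the kernel of `χ` acts through an `ℓ`-group, which has
  non-zero fixed vectors.

All statements are abstract; no modular input is formalised here.
-/

namespace Summit.Langlands.Langlands.Theorems

/-- Pointwise dichotomy between two homomorphisms is global. -/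
theorem soloBlind_hom_dichotomy {G M : Type*} [Group G] [Group M] (ψ χ₁ χ₂ : G →* M)
    (h : ∀ g, ψ g = χ₁ g ∨ ψ g = χ₂ g) : ψ = χ₁ ∨ ψ = χ₂ := by
  by_cases h1 : ψ = χ₁
  · exact Or.inl h1
  by_cases h2 : ψ = χ₂
  · exact Or.inr h2
  exfalso
  obtain ⟨a, ha⟩ : ∃ a, ψ a ≠ χ₁ a := by simpa [MonoidHom.ext_iff] using h1
  obtain ⟨b, hb⟩ : ∃ b, ψ b ≠ χ₂ b := by simpa [MonoidHom.ext_iff] using h2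
  have ha2 : ψ a = χ₂ a := (h a).resolve_left ha
  have hb1 : ψ b = χ₁ b := (h b).resolve_right hb
  rcases h (a * b) with hab | hab
  · rw [map_mul, map_mul, ha2, hb1] at hab
    exact ha (ha2.trans (mul_right_cancel hab))
  · rw [map_mul, map_mul, ha2, hb1] at hab
    exact hb (hb1.trans (mul_left_cancel hab))

/-- The same statement deduced from the landed folklore lemma, via the two equaliser subgroups
`{g | ψ g = χᵢ g}`. -/
theorem soloBlind_hom_dichotomy' {G M : Type*} [Group G] [Group M] (ψ χ₁ χ₂ : G →* M)
    (h : ∀ g, ψ g = χ₁ g ∨ ψ g = χ₂ g) : ψ = χ₁ ∨ ψ = χ₂ := by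
  rcases Literature.RepresentationTheory.Semisimple.subgroup_eq_top_or_eq_top_of_union
      (ψ.eqLocus χ₁) (ψ.eqLocus χ₂) h with hA | hB
  · exact Or.inl (MonoidHom.ext fun g => (hA ▸ Subgroup.mem_top g : g ∈ ψ.eqLocus χ₁))
  · exact Or.inr (MonoidHom.ext fun g => (hB ▸ Subgroup.mem_top g : g ∈ ψ.eqLocus χ₂))

/-- The form used in Ψ1: a character that is pointwise `1` or `χ` is `1` or `χ`. -/
theorem soloBlind_hom_one_or_chi {G M : Type*} [Group G] [Group M] (ψ χ : G →* M)
    (h : ∀ g, ψ g = 1 ∨ ψ g = χ g) : ψ = 1 ∨ ψ = χ :=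
  soloBlind_hom_dichotomy ψ 1 χ (by simpa using h)

/-- In characteristic `ℓ`, `u ^ 2 = 0` forces `(1 + u) ^ ℓ = 1`: an endomorphism `g` with
`(g - 1)^2 = 0` has order dividing `ℓ`. -/
theorem soloBlind_unipotent_pow_char {R : Type*} [Ring R] (ℓ : ℕ) [hp : Fact ℓ.Prime] [CharP R ℓ]
    (u : R) (hu : u ^ 2 = 0) : (1 + u) ^ ℓ = 1 := by
  have hc : Commute (1 : R) u := Commute.one_left u
  rw [add_pow_char_of_commute (p := ℓ) hc, one_pow, pow_eq_zero_of_le hp.out.two_le hu, add_zero]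

/-- Sanity instance: in `ZMod 5`, with `u = 0` trivially; and a `2 × 2` unipotent matrix over
`ZMod 5` has fifth power `1`. -/
example : ((1 : Matrix (Fin 2) (Fin 2) (ZMod 5)) + !![0, 1; 0, 0]) ^ 5 = 1 := by
  have hu : (!![0, 1; 0, 0] : Matrix (Fin 2) (Fin 2) (ZMod 5)) ^ 2 = 0 := by
    ext i j; fin_cases i <;> fin_cases j <;> simp [sq, Matrix.mul_apply, Fin.sum_univ_two]
  haveI : Fact (Nat.Prime 5) := ⟨by norm_num⟩
  exact soloBlind_unipotent_pow_char 5 _ hu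

end Summit.Langlands.Langlands.Theorems
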